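import Summits.ResolutionOfSingularities.ResolutionOfSingularities.Theorems.WildConesCampaignW46HypersurfacesCharTwoNearCount

/-!
# [OURS · L1 W4.6, rung (ii) at p = 2, EVERY dimension n; threefolds in particular] PAIR-FREE DOUBLE POINTS:
# for an isolated double point of `z² = a(u₁,…,uₙ)` WITHOUT hyperbolic pair (cleaned order `≥ 3`, `e = n`)
# the infinitely-near double points are exactly the zeros of the TANGENT CUBIC `a₃` in the whole exceptional
# `ℙ^{n−1}` — for a threefold (`n = 3`) a plane cubic curve, or all of `ℙ²` — and for `n ≥ 3` none of them
# is isolated; every field of characteristic 2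

HONEST FRAMING. Everything here is OURS: theorems about route WildCones' own TYPED point-blow-up dynamics
(`Theorems/WildConesClassicalRegimesDefs.lean`: `step`, `MultP`, `OrdP`, `Isol`) and the seat's invariants
`polarMatrix` (p502936), `milnorEmbDim` (p498937), `degForm` (p522667). NOTHING here is a statement of the
manuscript [Hironaka2017]; no FACT-LIST premise; AI review is weaker than expert review. Cell res-hironaka
(LADDER-RESOLUTION rung L, D-0089), slot W4.6 «(ii) THREEFOLD HYPERSURFACES», seat res-L1-s46-pv-4 (gen 5);
host route `WildCones`, crux `ClassicalRegimes` (stmt-ResolutionOfSingularities-16884; proved).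

WHY. For threefolds (`n = 3`) the corank is `e = 1` (the hyperbolic-splitting regime, gens 0–3) or `e = 3`
(no hyperbolic pair, cleaned order `≥ 3`: gen 2's `FermatExit` showed the Fermat cubic leaves the regime
sideways). The near-point criterion (p524988) makes the second case explicit in every dimension: the polar
matrix is ZERO, so the kernel is everything and the near double points are the zeros of `a₃` in `ℙ^{n−1}`.

WHAT IS PROVED (every `n`, every field of characteristic `2`):

* `polarMatrix_eq_zero_of_not_ordP` — no hyperbolic pair ⇒ `P = 0`;
* `hypersurface_multP_step_iff_cubic_of_not_ordP` — **isolated pair-free double state: `MultP (step i τ c) ↔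
  a₃(w) = 0`**, `w = (τ with w_i = 1)`: the near double points are the points of the cubic hypersurface
  `{a₃ = 0} ⊂ ℙ^{n−1}` (for `n = 3`: a plane cubic CURVE of near double points, or the whole plane);
* `hypersurface_pairFree_near_not_isol` — `n ≥ 3`: each of these successors is NON-isolated (gen 3,
  `hypersurface_not_isol_step_of_three_le`): the forced procedure stops; `threefold_pairFree_near` — the
  threefold reading (`n = 3`, `¬OrdP`): criterion and non-isolatedness together.

References: [GreuelPfister2026] (context); [Hironaka2017] Th. 16.6 p.84 — role replaced only (the next
centre for order-`≥ 3` double points of threefolds is a CURVE of the exceptional plane, not a point).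
-/

noncomputable section

-- single-problem summit: the doubled namespace component `ResolutionOfSingularities` is forced
set_option linter.dupNamespace false

open scoped BigOperators Classical

open MvPowerSeries IsLocalRing

open Literature.AlgebraicGeometry.Resolution

namespace Summit.ResolutionOfSingularities.ResolutionOfSingularities.Theorems

namespace CampaignW46.HypersurfacesCharTwo

open WildCones WildCones.MuDropCharTwoOrdP ThreefoldsCharTwo

variable {κ : Type} [Field κ] {n : ℕ}

/-- [OURS · L1 W4.6] **No hyperbolic pair ⇒ the polar matrix vanishes** (characteristic `2`): `¬OrdP c`
says that no square-free quadratic monomial `u_j u_l` occurs in the cleaned series, i.e. every entry of the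
polar matrix is `0`. [folklore] -/
theorem polarMatrix_eq_zero_of_not_ordP [CharP κ 2] {c : (Fin n → ℕ) → κ} (hO : ¬ OrdP 2 n κ c) :
    polarMatrix (ser 2 n κ c) = 0 := by
  rw [ordP_two_iff_exists_pair] at hO
  push Not at hO
  ext s t
  simp only [polarMatrix, Matrix.of_apply, Matrix.zero_apply]
  by_cases hst : s = t
  · rw [if_pos hst]
  · rw [if_neg hst]
    exact hO s t hst

/-- [OURS · L1 W4.6 rung (ii) at `p = 2`, every dimension; NOT a statement of the manuscript] **PAIR-FREE
ISOLATED DOUBLE POINTS: THE NEAR DOUBLE POINTS ARE THE ZEROS OF THE TANGENT CUBIC IN `ℙ^{n−1}`.** For an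
isolated double state `c` of `z² = a(u₁,…,uₙ)` (any field of characteristic `2`) without hyperbolic pair
(`¬OrdP c`: cleaned order `≥ 3`, `e(c) = n`), chart `i`, translation `τ`: the successor is a double point
IFF `degForm 3 (ser c) (τ with i ↦ 1) = 0`. For a THREEFOLD (`n = 3`) the near double points thus form the
plane cubic curve `{a₃ = 0} ⊂ ℙ²` (or all of `ℙ²` when `a₃` has no non-zero value). [folklore] -/
theorem hypersurface_multP_step_iff_cubic_of_not_ordP [CharP κ 2] (c : (Fin n → ℕ) → κ) (i : Fin n)
    (τ : Fin n → κ) (hM : MultP 2 n κ c) (hI : Isol 2 n κ c) (hO : ¬ OrdP 2 n κ c) :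
    MultP 2 n κ (step 2 n κ i τ c) ↔ degForm 3 (ser 2 n κ c) (Function.update τ i 1) = 0 := by
  rw [hypersurface_multP_step_iff c i τ hM hI, polarMatrix_eq_zero_of_not_ordP hO, Matrix.vecMul_zero]
  exact ⟨fun h => h.2, fun h => ⟨rfl, h⟩⟩

/-- [OURS · L1 W4.6 rung (ii) at `p = 2`, every dimension `n ≥ 3`; NOT a statement of the manuscript]
**… AND NONE OF THEM IS ISOLATED**: for a pair-free double state in `n ≥ 3` variables every double
successor is NON-isolated (`e(c) = n ≥ 3`, gen 3's `hypersurface_not_isol_step_of_three_le`): the forced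
(isolated) procedure of crux `ClassicalRegimes` stops at such a state, the unforced one meets a positive-
dimensional singular locus. [folklore] -/
theorem hypersurface_pairFree_near_not_isol [CharP κ 2] (hn : 3 ≤ n) (c : (Fin n → ℕ) → κ) (i : Fin n)
    (τ : Fin n → κ) (hM : MultP 2 n κ c) (hO : ¬ OrdP 2 n κ c) (hM' : MultP 2 n κ (step 2 n κ i τ c)) :
    ¬ Isol 2 n κ (step 2 n κ i τ c) :=
  hypersurface_not_isol_step_of_three_le c i τ hM (by rw [(not_ordP_iff_milnorEmbDim_eq hM).mp hO]; exact hn) hM'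

/-- [OURS · L1 W4.6 rung (ii) at `p = 2`, THREEFOLDS; NOT a statement of the manuscript] **THE THREEFOLD
READING**: for an isolated double point of a threefold hypersurface `z² = a(u₀,u₁,u₂)` over any field of
characteristic `2` WITHOUT hyperbolic pair (cleaned order `≥ 3` — the only corank besides the
hyperbolic-splitting regime `e = 1`): a chart `i` and translation `τ` give a double successor iff the
tangent cubic vanishes at `(τ with i ↦ 1)`, and then that successor is NOT isolated. The infinitely-near
double points form the plane cubic `a₃ = 0` of the exceptional `ℙ²` and the forced procedure stops there
(gen 2's Fermat example `u₀³+u₁³+u₂³`, p483423, is the instance `a₃ =` Fermat cubic). [folklore] -/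
theorem threefold_pairFree_near [CharP κ 2] (c : (Fin 3 → ℕ) → κ) (i : Fin 3) (τ : Fin 3 → κ)
    (hM : MultP 2 3 κ c) (hI : Isol 2 3 κ c) (hO : ¬ OrdP 2 3 κ c) :
    (MultP 2 3 κ (step 2 3 κ i τ c) ↔ degForm 3 (ser 2 3 κ c) (Function.update τ i 1) = 0) ∧
      (MultP 2 3 κ (step 2 3 κ i τ c) → ¬ Isol 2 3 κ (step 2 3 κ i τ c)) :=
  ⟨hypersurface_multP_step_iff_cubic_of_not_ordP c i τ hM hI hO,
    fun hM' => hypersurface_pairFree_near_not_isol le_rfl c i τ hM hO hM'⟩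

/-- [OURS · L1 W4.6 rung (ii) at `p = 2`, THREEFOLDS; NOT a statement of the manuscript] **THE THREEFOLD
DICHOTOMY BY THE 3-JET**: an isolated double point of a threefold `z² = a(u₀,u₁,u₂)` (characteristic `2`)
EITHER is in the hyperbolic-splitting regime (`OrdP`; then gens 2–3: a unique near double point iff
`a₃(w₀) = 0` at the kernel point, a chain of length `μ/2`), OR has no hyperbolic pair, and then every
point of the plane cubic `a₃ = 0` in the exceptional `ℙ²` is a non-isolated near double point. Stated as
the disjunction of the two kernel descriptions. [folklore] -/
theorem threefold_near_dichotomy [CharP κ 2] (c : (Fin 3 → ℕ) → κ) (hM : MultP 2 3 κ c) (hI : Isol 2 3 κ c) :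
    (OrdP 2 3 κ c ∧ milnorEmbDim 2 3 κ c = 1) ∨
      (¬ OrdP 2 3 κ c ∧ ∀ (i : Fin 3) (τ : Fin 3 → κ),
        (MultP 2 3 κ (step 2 3 κ i τ c) ↔ degForm 3 (ser 2 3 κ c) (Function.update τ i 1) = 0) ∧
          (MultP 2 3 κ (step 2 3 κ i τ c) → ¬ Isol 2 3 κ (step 2 3 κ i τ c))) := by
  by_cases hO : OrdP 2 3 κ c
  · exact Or.inl ⟨hO, (threefold_milnorEmbDim_eq hM).1 hO⟩
  · exact Or.inr ⟨hO, fun i τ => threefold_pairFree_near c i τ hM hI hO⟩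

end CampaignW46.HypersurfacesCharTwo

end Summit.ResolutionOfSingularities.ResolutionOfSingularities.Theorems

end
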